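import Mathlib.Analysis.SpecialFunctions.Integrals.Basic
import Mathlib.Analysis.SpecialFunctions.Pow.Asymptotics
import Mathlib.Analysis.SpecialFunctions.Gamma.Basic
import Mathlib.MeasureTheory.Function.JacobianOneDim
import Literature.Analysis.Asymptotics.LogPowerScale
import HarnessLib

/-!
# Power–logarithm moments `∫₀ᴸ tˢ logᵏ t dt` (Gradshteyn–Ryzhik 2.721 1, 2.722, 2.723, 4.272 6)

Topic `Literature/Analysis/SpecialFunctions`; namespace `Literature.Analysis.SpecialFunctions`.
Everything in this file is PROVED (no named fact, no axiom); the statements are the classical table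
entries, restricted to real parameters, for the endpoint-weight moments

  `m(s, k; L) = ∫₀ᴸ tˢ (log t)ᵏ dt`,   `s > −1` real, `k ∈ ℕ`, `L > 0`,

i.e. the integrals of a monomial against an algebraic–logarithmic endpoint weight `t^α logᵏ t`
(`s = α + i`).  Contents:

* `intervalIntegrable_rpow_mul_log_pow` — `t ↦ tˢ logᵏ t` is interval integrable on `[0, L]` for
  `s > −1` (domination by `t^{(s−1)/2}` on `(0, 1]`, via `|log t|ᵏ t^δ ≤ (k/δ)ᵏ`);
* `integral_rpow_mul_log_pow_succ` — the REDUCTION FORMULA (GR 2.721 1 taken between `0` and `L`):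
  `m(s, k+1; L) = (L^{s+1} (log L)^{k+1} − (k+1)·m(s, k; L)) / (s+1)`, with
  `m(s, 0; L) = L^{s+1}/(s+1)` (`integral_rpow_mul_log_pow_zero`);
* `integral_rpow_mul_log_pow_eq` — the CLOSED FORM (GR 2.722 between `0` and `L`):
  `m(s, k; L) = L^{s+1} Σ_{j=0}^{k} (−1)ʲ k(k−1)⋯(k−j+1) (log L)^{k−j} / (s+1)^{j+1}`
  (`k(k−1)⋯(k−j+1) = Nat.descFactorial k j`), the cases `k = 1, 2, 3`
  written out (GR 2.723 1–3), and the moments against shifted monomials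
  `∫₀^δ t^α logᵏ t (t − e)ʲ dt = Σ_i C(j,i) (−e)^{j−i} m(α+i, k; δ)`
  (`integral_rpow_mul_log_pow_mul_sub_pow`);
* `integral_rpow_mul_log_pow_zero_one` — the unit-interval value
  `∫₀¹ tˢ logᵏ t dt = (−1)ᵏ k!/(s+1)^{k+1}`, and in the table's own shape (GR 4.272 6 with
  `μ = k + 1 ∈ ℕ`, `ν = s + 1`) `∫₀¹ (−log x)ᵏ x^{ν−1} dx = Γ(k+1)/ν^{k+1}`
  (`integral_neg_log_pow_mul_rpow`); and GR 4.272 6 itself for REAL `μ, ν > 0`,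
  `∫₀¹ (−log x)^{μ−1} x^{ν−1} dx = Γ(μ)/ν^μ` (`integral_neg_log_rpow_mul_rpow`), by the substitution
  `x = e^{−u}` onto Euler's integral `∫₀^∞ u^{μ−1} e^{−νu} du = Γ(μ)/ν^μ`
  (Mathlib's `Real.integral_rpow_mul_exp_neg_mul_Ioi`) — an independent second derivation of the
  integer case.

The antiderivative behind the reduction is `t^{s+1} (log t)^{k+1}` (`hasDerivAt_rpow_succ_mul_log_pow`),
whose value at `0⁺` is `0` (the tree lemma
`Literature.Analysis.Asymptotics.tendsto_rpow_mul_log_pow_nhdsGT_zero`, from Mathlib's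
`tendsto_log_mul_rpow_nhdsGT_zero`).  Mathlib supplies the `k = 0` case (`integral_rpow`); the earlier
tree lemmas `Literature.Analysis.ValidatedNumerics.PolyMP.integral_pow_mul_log{,_sq}` are the cases
`s ∈ ℕ`, `k = 1, 2`.

## References

* I. S. Gradshteyn, I. M. Ryzhik, *Table of Integrals, Series, and Products*, 8th ed.
  (D. Zwillinger, V. Moll, eds.), Elsevier/Academic Press 2015: 1.111 (binomial theorem), 2.721 1
  (reduction formula for `∫ xⁿ lnᵐ x dx`), 2.722 (its closed form), 2.723 1–3 (`m = 1, 2, 3`),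
  4.272 6 (`∫₀¹ (−ln x)^{μ−1} x^{ν−1} dx = Γ(μ)/ν^μ`, `Re μ, Re ν > 0`; BI (107)(3)).
  [GradshteynRyzhik2015]
-/

noncomputable section

open Real Set MeasureTheory intervalIntegral Filter
open scoped Topology

namespace Literature.Analysis.SpecialFunctions

/-! ### Pointwise tools -/

/-- (Helper.) On `(0, 1]`: `|log t|ᵏ · t^δ ≤ (k/δ)ᵏ` for `δ > 0` (from Mathlib's
`|log t · t^{δ/k}| < k/δ`). [folklore] -/
private theorem abs_log_pow_mul_rpow_le {t δ : ℝ} (ht0 : 0 < t) (ht1 : t ≤ 1) (hδ : 0 < δ) (k : ℕ) :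
    |Real.log t| ^ k * t ^ δ ≤ ((k : ℝ) / δ) ^ k := by
  rcases Nat.eq_zero_or_pos k with rfl | hk
  · simpa using Real.rpow_le_one ht0.le ht1 hδ.le
  · have hk' : (0 : ℝ) < k := by exact_mod_cast hk
    have h := Real.abs_log_mul_self_rpow_lt t (δ / k) ht0 ht1 (by positivity)
    rw [one_div_div, abs_mul, abs_of_pos (Real.rpow_pos_of_pos ht0 _)] at h
    have hpow : t ^ δ = (t ^ (δ / k)) ^ k := by
      rw [← Real.rpow_natCast, ← Real.rpow_mul ht0.le, div_mul_cancel₀ δ hk'.ne']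
    rw [hpow, ← mul_pow]
    exact pow_le_pow_left₀ (by positivity) h.le k

/-- (Helper.) `t ↦ tˢ logᵏ t` is continuous on `(0, ∞)`. [folklore] -/
private theorem continuousOn_rpow_mul_log_pow (s : ℝ) (k : ℕ) :
    ContinuousOn (fun t : ℝ => t ^ s * Real.log t ^ k) (Ioi 0) :=
  (continuousOn_id.rpow_const fun _ ht => Or.inl (ne_of_gt ht)).mul
    ((Real.continuousOn_log.mono fun _ ht => ne_of_gt ht).pow k)

/-- **Gradshteyn–Ryzhik 2.721 1 in differential form** (the indefinite-integral identity
`∫ xⁿ lnᵐ x dx = x^{n+1} lnᵐ x/(n+1) − (m/(n+1)) ∫ xⁿ ln^{m−1} x dx` says precisely that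
`x^{n+1} lnᵐ x` is an antiderivative of `(n+1) xⁿ lnᵐ x + m xⁿ ln^{m−1} x`), real exponent, `t > 0`:
`d/dt [t^{s+1} (log t)^{k+1}] = (s+1) tˢ (log t)^{k+1} + (k+1) tˢ (log t)ᵏ`.
[cite: GradshteynRyzhik2015, 2.721 1] -/
theorem hasDerivAt_rpow_succ_mul_log_pow (s : ℝ) (k : ℕ) {x : ℝ} (hx : 0 < x) :
    HasDerivAt (fun t : ℝ => t ^ (s + 1) * Real.log t ^ (k + 1))
      ((s + 1) * (x ^ s * Real.log x ^ (k + 1)) + (k + 1) * (x ^ s * Real.log x ^ k)) x := by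
  have h1 : HasDerivAt (fun t : ℝ => t ^ (s + 1)) ((s + 1) * x ^ s) x := by
    simpa using Real.hasDerivAt_rpow_const (p := s + 1) (Or.inl hx.ne')
  have h2 : HasDerivAt (fun t : ℝ => Real.log t ^ (k + 1))
      (((k + 1 : ℕ) : ℝ) * Real.log x ^ (k + 1 - 1) * x⁻¹) x :=
    (Real.hasDerivAt_log hx.ne').fun_pow (k + 1)
  refine (h1.fun_mul h2).congr_deriv ?_
  rw [Real.rpow_add_one hx.ne' s]
  push_cast
  field_simp

/-! ### Integrability -/

/-- **Integrability** (the convergence clause `[Re μ > 0, Re ν > 0]` of Gradshteyn–Ryzhik 4.272 6,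
real case `μ = k + 1`, `ν = s + 1`, on `[0, 1]`; on `[1, L]` the integrand is continuous): for real
`s > −1`, `k ∈ ℕ` and `L ≥ 0`, `t ↦ tˢ logᵏ t` is interval integrable on `[0, L]`.
[cite: GradshteynRyzhik2015, 4.272 6] -/
theorem intervalIntegrable_rpow_mul_log_pow {s : ℝ} (hs : -1 < s) (k : ℕ) {L : ℝ} (hL : 0 ≤ L) :
    IntervalIntegrable (fun t : ℝ => t ^ s * Real.log t ^ k) volume 0 L := by
  rcases hL.eq_or_lt with rfl | hL'
  · exact IntervalIntegrable.refl
  have h01 : IntervalIntegrable (fun t : ℝ => t ^ s * Real.log t ^ k) volume 0 1 := by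
    rw [intervalIntegrable_iff_integrableOn_Ioc_of_le zero_le_one]
    set δ : ℝ := (s + 1) / 2 with hδ
    have hδ0 : 0 < δ := by rw [hδ]; linarith
    have hs' : -1 < s - δ := by rw [hδ]; linarith
    have hg : IntegrableOn (fun t : ℝ => ((k : ℝ) / δ) ^ k * t ^ (s - δ)) (Ioc 0 1) volume :=
      Integrable.const_mul ((intervalIntegrable_iff_integrableOn_Ioc_of_le zero_le_one).mp
        (intervalIntegral.intervalIntegrable_rpow' hs')) _
    refine Integrable.mono' hg
      (((continuousOn_rpow_mul_log_pow s k).mono Ioc_subset_Ioi_self).aestronglyMeasurable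
        measurableSet_Ioc) ?_
    refine (ae_restrict_iff' measurableSet_Ioc).2 (Eventually.of_forall fun t ht => ?_)
    have ht0 : 0 < t := ht.1
    rw [Real.norm_eq_abs, abs_mul, abs_of_pos (Real.rpow_pos_of_pos ht0 s), abs_pow]
    have hb := abs_log_pow_mul_rpow_le ht0 ht.2 hδ0 k
    have hts : 0 ≤ t ^ (s - δ) := (Real.rpow_pos_of_pos ht0 _).le
    calc t ^ s * |Real.log t| ^ k = (|Real.log t| ^ k * t ^ δ) * t ^ (s - δ) := by
            rw [mul_assoc, ← Real.rpow_add ht0, add_sub_cancel, mul_comm]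
      _ ≤ ((k : ℝ) / δ) ^ k * t ^ (s - δ) := mul_le_mul_of_nonneg_right hb hts
  have h1L : IntervalIntegrable (fun t : ℝ => t ^ s * Real.log t ^ k) volume 1 L := by
    refine ((continuousOn_rpow_mul_log_pow s k).mono fun t ht => ?_).intervalIntegrable
    exact lt_of_lt_of_le (lt_min zero_lt_one hL') ht.1
  exact h01.trans h1L

/-! ### The reduction formula and the closed form -/

/-- `k = 0` (**Gradshteyn–Ryzhik 2.722 with `m = 0`**, between `0` and `L`): `∫₀ᴸ tˢ dt = L^{s+1}/(s+1)`
(`s > −1`; Mathlib's `integral_rpow`). [cite: GradshteynRyzhik2015, 2.722] -/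
theorem integral_rpow_mul_log_pow_zero {s : ℝ} (hs : -1 < s) (L : ℝ) :
    ∫ t in (0 : ℝ)..L, t ^ s * Real.log t ^ 0 = L ^ (s + 1) / (s + 1) := by
  simp only [pow_zero, mul_one]
  rw [integral_rpow (Or.inl hs), Real.zero_rpow (by linarith)]
  ring

/-- **Gradshteyn–Ryzhik 2.721 1** (reduction formula `∫ xⁿ lnᵐ x dx = x^{n+1} lnᵐ x/(n+1)
− (m/(n+1)) ∫ xⁿ ln^{m−1} x dx`), taken between `0` and `L > 0`, for real exponent `s > −1` and
`m = k + 1`: `∫₀ᴸ tˢ log^{k+1} t dt = (L^{s+1} log^{k+1} L − (k+1) ∫₀ᴸ tˢ logᵏ t dt)/(s+1)`.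
[cite: GradshteynRyzhik2015, 2.721 1] -/
theorem integral_rpow_mul_log_pow_succ {s : ℝ} (hs : -1 < s) (k : ℕ) {L : ℝ} (hL : 0 < L) :
    ∫ t in (0 : ℝ)..L, t ^ s * Real.log t ^ (k + 1) =
      (L ^ (s + 1) * Real.log L ^ (k + 1)
        - (k + 1) * ∫ t in (0 : ℝ)..L, t ^ s * Real.log t ^ k) / (s + 1) := by
  have hs1 : s + 1 ≠ 0 := by linarith
  have hI1 := intervalIntegrable_rpow_mul_log_pow hs (k + 1) hL.le
  have hI0 := intervalIntegrable_rpow_mul_log_pow hs k hL.le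
  have hFTC := intervalIntegral.integral_eq_sub_of_hasDerivAt_of_tendsto hL
      (f := fun t : ℝ => t ^ (s + 1) * Real.log t ^ (k + 1))
      (f' := fun x : ℝ => (s + 1) * (x ^ s * Real.log x ^ (k + 1)) + (k + 1) * (x ^ s * Real.log x ^ k))
      (fa := 0) (fb := L ^ (s + 1) * Real.log L ^ (k + 1))
      (fun x hx => hasDerivAt_rpow_succ_mul_log_pow s k hx.1)
      ((hI1.const_mul (s + 1)).add (hI0.const_mul (k + 1)))
      (Literature.Analysis.Asymptotics.tendsto_rpow_mul_log_pow_nhdsGT_zero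
        (by linarith : 0 < s + 1) (k + 1))
      ((((continuousOn_rpow_mul_log_pow (s + 1) (k + 1)).continuousAt
        (Ioi_mem_nhds hL)).tendsto).mono_left nhdsWithin_le_nhds)
  rw [intervalIntegral.integral_add (hI1.const_mul _) (hI0.const_mul _),
    intervalIntegral.integral_const_mul, intervalIntegral.integral_const_mul, sub_zero] at hFTC
  rw [eq_div_iff hs1]
  linear_combination hFTC

/-- (Helper.) The `m = 0` instance of the right-hand side of 2.722. [folklore] -/
private theorem closedForm_zero (s L : ℝ) :
    L ^ (s + 1) * ∑ j ∈ Finset.range (0 + 1),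
        (-1) ^ j * ((0 : ℕ).descFactorial j : ℝ) * Real.log L ^ (0 - j) / (s + 1) ^ (j + 1)
      = L ^ (s + 1) / (s + 1) := by
  simp [div_eq_mul_inv]

/-- (Helper.) The right-hand side of 2.722 satisfies the reduction formula 2.721 1 (this is how 2.722
follows from 2.721 1). [folklore] -/
private theorem closedForm_succ {s : ℝ} (hs1 : s + 1 ≠ 0) (k : ℕ) (L : ℝ) :
    L ^ (s + 1) * ∑ j ∈ Finset.range (k + 1 + 1),
        (-1) ^ j * ((k + 1).descFactorial j : ℝ) * Real.log L ^ (k + 1 - j) / (s + 1) ^ (j + 1)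
      = (L ^ (s + 1) * Real.log L ^ (k + 1) - (k + 1) * (L ^ (s + 1) * ∑ j ∈ Finset.range (k + 1),
          (-1) ^ j * (k.descFactorial j : ℝ) * Real.log L ^ (k - j) / (s + 1) ^ (j + 1))) / (s + 1) := by
  rw [Finset.sum_range_succ']
  have key : ∀ j ∈ Finset.range (k + 1),
      (-1 : ℝ) ^ (j + 1) * ((k + 1).descFactorial (j + 1) : ℝ) * Real.log L ^ (k + 1 - (j + 1))
          / (s + 1) ^ (j + 1 + 1)
        = -((k + 1) / (s + 1))
          * ((-1 : ℝ) ^ j * (k.descFactorial j : ℝ) * Real.log L ^ (k - j) / (s + 1) ^ (j + 1)) := by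
    intro j _
    rw [Nat.succ_descFactorial_succ, Nat.add_sub_add_right]
    push_cast
    field_simp
    ring
  rw [Finset.sum_congr rfl key, ← Finset.mul_sum]
  simp only [Nat.descFactorial_zero, Nat.cast_one, pow_zero, Nat.sub_zero, zero_add, pow_one, mul_one,
    one_mul]
  field_simp
  ring

/-- **Gradshteyn–Ryzhik 2.722** (closed form of `∫ xⁿ lnᵐ x dx`,
`= x^{n+1} Σ_{k=0}^{m} (−1)ᵏ (m+1)m(m−1)⋯(m−k+1) ln^{m−k} x / ((m+1)(n+1)^{k+1})`), taken between `0`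
and `L > 0`, real exponent `s > −1`, `m = k`:
`∫₀ᴸ tˢ logᵏ t dt = L^{s+1} Σ_{j=0}^{k} (−1)ʲ k(k−1)⋯(k−j+1) (log L)^{k−j}/(s+1)^{j+1}`
(`k(k−1)⋯(k−j+1) = Nat.descFactorial k j = k!/(k−j)!`; the lower limit contributes `0`).
[cite: GradshteynRyzhik2015, 2.722] -/
theorem integral_rpow_mul_log_pow_eq {s : ℝ} (hs : -1 < s) (k : ℕ) {L : ℝ} (hL : 0 < L) :
    ∫ t in (0 : ℝ)..L, t ^ s * Real.log t ^ k =
      L ^ (s + 1) * ∑ j ∈ Finset.range (k + 1),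
        (-1) ^ j * (k.descFactorial j : ℝ) * Real.log L ^ (k - j) / (s + 1) ^ (j + 1) := by
  induction k with
  | zero => rw [integral_rpow_mul_log_pow_zero hs, closedForm_zero]
  | succ k ih =>
    rw [integral_rpow_mul_log_pow_succ hs k hL, ih, closedForm_succ (by linarith) k L]

/-- The cases `k = 1, 2, 3` written out (**Gradshteyn–Ryzhik 2.723 1–3** between `0` and `L`), obtained
here from the reduction formula: `∫₀ᴸ tˢ log t = L^{s+1}(log L/(s+1) − 1/(s+1)²)`.
[cite: GradshteynRyzhik2015, 2.723 1] -/
theorem integral_rpow_mul_log {s : ℝ} (hs : -1 < s) {L : ℝ} (hL : 0 < L) :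
    ∫ t in (0 : ℝ)..L, t ^ s * Real.log t =
      L ^ (s + 1) * (Real.log L / (s + 1) - 1 / (s + 1) ^ 2) := by
  have hs1 : s + 1 ≠ 0 := by linarith
  have h := integral_rpow_mul_log_pow_succ hs 0 hL
  simp only [zero_add, pow_one, Nat.cast_zero, one_mul, integral_rpow_mul_log_pow_zero hs] at h
  rw [h]
  field_simp

/-- `∫₀ᴸ tˢ log² t = L^{s+1}(log² L/(s+1) − 2 log L/(s+1)² + 2/(s+1)³)`.
[cite: GradshteynRyzhik2015, 2.723 2] -/
theorem integral_rpow_mul_log_sq {s : ℝ} (hs : -1 < s) {L : ℝ} (hL : 0 < L) :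
    ∫ t in (0 : ℝ)..L, t ^ s * Real.log t ^ 2 =
      L ^ (s + 1) * (Real.log L ^ 2 / (s + 1) - 2 * Real.log L / (s + 1) ^ 2 + 2 / (s + 1) ^ 3) := by
  have hs1 : s + 1 ≠ 0 := by linarith
  have h := integral_rpow_mul_log_pow_succ hs 1 hL
  simp only [pow_one, Nat.cast_one, integral_rpow_mul_log hs hL] at h
  rw [show (2 : ℕ) = 1 + 1 from rfl, h]
  field_simp
  ring

/-- `∫₀ᴸ tˢ log³ t = L^{s+1}(log³ L/(s+1) − 3 log² L/(s+1)² + 6 log L/(s+1)³ − 6/(s+1)⁴)`.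
[cite: GradshteynRyzhik2015, 2.723 3] -/
theorem integral_rpow_mul_log_pow_three {s : ℝ} (hs : -1 < s) {L : ℝ} (hL : 0 < L) :
    ∫ t in (0 : ℝ)..L, t ^ s * Real.log t ^ 3 =
      L ^ (s + 1) * (Real.log L ^ 3 / (s + 1) - 3 * Real.log L ^ 2 / (s + 1) ^ 2
        + 6 * Real.log L / (s + 1) ^ 3 - 6 / (s + 1) ^ 4) := by
  have hs1 : s + 1 ≠ 0 := by linarith
  have h := integral_rpow_mul_log_pow_succ hs 2 hL
  rw [integral_rpow_mul_log_sq hs hL] at h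
  rw [show (3 : ℕ) = 2 + 1 from rfl, h]
  push_cast
  field_simp
  ring

/-- Moments against SHIFTED monomials: the binomial theorem **Gradshteyn–Ryzhik 1.111**,
`(a + x)ⁿ = Σ_{k=0}^{n} C(n, k) xᵏ a^{n−k}`, with `a = −e`, `x = t`, `n = j`, under the integral sign
(linearity; every term is integrable by `intervalIntegrable_rpow_mul_log_pow`): for `α > −1`,
`k, j ∈ ℕ`, `e ∈ ℝ`, `δ ≥ 0`,
`∫₀^δ t^α logᵏ t (t − e)ʲ dt = Σ_{i=0}^{j} C(j, i) (−e)^{j−i} ∫₀^δ t^{α+i} logᵏ t dt`.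
[cite: GradshteynRyzhik2015, 1.111] -/
theorem integral_rpow_mul_log_pow_mul_sub_pow {α : ℝ} (hα : -1 < α) (k j : ℕ) (e : ℝ) {δ : ℝ}
    (hδ : 0 ≤ δ) :
    ∫ t in (0 : ℝ)..δ, t ^ α * Real.log t ^ k * (t - e) ^ j =
      ∑ i ∈ Finset.range (j + 1),
        (j.choose i : ℝ) * (-e) ^ (j - i) * ∫ t in (0 : ℝ)..δ, t ^ (α + i) * Real.log t ^ k := by
  have hI : ∀ i ∈ Finset.range (j + 1), IntervalIntegrable
      (fun t : ℝ => (j.choose i : ℝ) * (-e) ^ (j - i) * (t ^ (α + i) * Real.log t ^ k)) volume 0 δ := by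
    intro i _
    have hαi : -1 < α + i := by have := Nat.cast_nonneg (α := ℝ) i; linarith
    exact (intervalIntegrable_rpow_mul_log_pow hαi k hδ).const_mul _
  have hae : ∀ᵐ t : ℝ, t ∈ Set.uIoc (0 : ℝ) δ →
      t ^ α * Real.log t ^ k * (t - e) ^ j
        = ∑ i ∈ Finset.range (j + 1),
            (j.choose i : ℝ) * (-e) ^ (j - i) * (t ^ (α + i) * Real.log t ^ k) := by
    refine Eventually.of_forall fun t ht => ?_
    have ht0 : 0 < t := by rw [Set.uIoc_of_le hδ] at ht; exact ht.1
    rw [sub_eq_add_neg, add_pow, Finset.mul_sum]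
    refine Finset.sum_congr rfl fun i _ => ?_
    rw [Real.rpow_add_natCast ht0.ne']
    ring
  rw [intervalIntegral.integral_congr_ae hae, intervalIntegral.integral_finsetSum hI]
  exact Finset.sum_congr rfl fun i _ => intervalIntegral.integral_const_mul _ _

/-! ### The unit interval: Gradshteyn–Ryzhik 4.272 6 -/

/-- `∫₀¹ tˢ logᵏ t dt = (−1)ᵏ k!/(s+1)^{k+1}` for real `s > −1` (GR 4.272 6 with `μ = k+1`, `ν = s+1`).
[cite: GradshteynRyzhik2015, 4.272 6] -/
theorem integral_rpow_mul_log_pow_zero_one {s : ℝ} (hs : -1 < s) (k : ℕ) :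
    ∫ t in (0 : ℝ)..1, t ^ s * Real.log t ^ k = (-1) ^ k * (k.factorial : ℝ) / (s + 1) ^ (k + 1) := by
  have hs1 : s + 1 ≠ 0 := by linarith
  induction k with
  | zero => rw [integral_rpow_mul_log_pow_zero hs, Real.one_rpow]; simp
  | succ k ih =>
    rw [integral_rpow_mul_log_pow_succ hs k one_pos, ih, Real.one_rpow, Real.log_one,
      zero_pow (Nat.succ_ne_zero _), mul_zero, zero_sub, Nat.factorial_succ]
    push_cast
    field_simp
    ring

/-- **Gradshteyn–Ryzhik 4.272 6**, `∫₀¹ (−ln x)^{μ−1} x^{ν−1} dx = Γ(μ)/ν^μ`, in the case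
`μ = k + 1 ∈ ℕ` and real `ν > 0`: `∫₀¹ (−log x)ᵏ x^{ν−1} dx = Γ(k+1)/ν^{k+1}` (`= k!/ν^{k+1}`).
[cite: GradshteynRyzhik2015, 4.272 6] -/
theorem integral_neg_log_pow_mul_rpow {ν : ℝ} (hν : 0 < ν) (k : ℕ) :
    ∫ x in (0 : ℝ)..1, (-Real.log x) ^ k * x ^ (ν - 1) = Real.Gamma (k + 1) / ν ^ (k + 1) := by
  have hs : -1 < ν - 1 := by linarith
  have h1 : (fun x : ℝ => (-Real.log x) ^ k * x ^ (ν - 1))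
      = fun x => (-1 : ℝ) ^ k * (x ^ (ν - 1) * Real.log x ^ k) := by
    funext x; rw [neg_pow]; ring
  rw [h1, intervalIntegral.integral_const_mul, integral_rpow_mul_log_pow_zero_one hs,
    Real.Gamma_nat_eq_factorial, sub_add_cancel, ← mul_div_assoc, ← mul_assoc, ← mul_pow, neg_one_mul,
    neg_neg, one_pow, one_mul]

/-- **Gradshteyn–Ryzhik 4.272 6** for real parameters: `∫₀¹ (−ln x)^{μ−1} x^{ν−1} dx = Γ(μ)/ν^μ`
(`μ > 0`, `ν > 0`; the table states it for `Re μ, Re ν > 0`).  Proof: the substitution `x = e^{−u}`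
(`u ∈ (0, ∞)`) turns the left side into Euler's integral `∫₀^∞ u^{μ−1} e^{−νu} du`.
[cite: GradshteynRyzhik2015, 4.272 6] -/
theorem integral_neg_log_rpow_mul_rpow {μ ν : ℝ} (hμ : 0 < μ) (hν : 0 < ν) :
    ∫ x in (0 : ℝ)..1, (-Real.log x) ^ (μ - 1) * x ^ (ν - 1) = Real.Gamma μ / ν ^ μ := by
  have himg : (fun u : ℝ => Real.exp (-u)) '' Ioi 0 = Ioo 0 1 := by
    ext x
    constructor
    · rintro ⟨u, hu, rfl⟩
      exact ⟨Real.exp_pos _, Real.exp_lt_one_iff.mpr (neg_lt_zero.mpr hu)⟩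
    · intro hx
      refine ⟨-Real.log x, ?_, ?_⟩
      · exact neg_pos.mpr (Real.log_neg hx.1 hx.2)
      · simp only [neg_neg, Real.exp_log hx.1]
  have hderiv : ∀ u ∈ Ioi (0 : ℝ),
      HasDerivWithinAt (fun u : ℝ => Real.exp (-u)) (-Real.exp (-u)) (Ioi 0) u := fun u _ =>
    (((Real.hasDerivAt_exp (-u)).comp u (hasDerivAt_neg u)).congr_deriv (by ring)).hasDerivWithinAt
  have hinj : InjOn (fun u : ℝ => Real.exp (-u)) (Ioi 0) :=
    (Real.exp_injective.comp neg_injective).injOn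
  have hcv := integral_image_eq_integral_abs_deriv_smul measurableSet_Ioi hderiv hinj
    (fun x : ℝ => (-Real.log x) ^ (μ - 1) * x ^ (ν - 1))
  rw [himg] at hcv
  have hpt : ∀ u ∈ Ioi (0 : ℝ),
      |-Real.exp (-u)| • ((-Real.log (Real.exp (-u))) ^ (μ - 1) * Real.exp (-u) ^ (ν - 1))
        = u ^ (μ - 1) * Real.exp (-(ν * u)) := by
    intro u _
    rw [abs_neg, abs_of_pos (Real.exp_pos _), Real.log_exp, neg_neg, smul_eq_mul, ← Real.exp_mul,
      show Real.exp (-u) * (u ^ (μ - 1) * Real.exp (-u * (ν - 1)))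
        = u ^ (μ - 1) * (Real.exp (-u) * Real.exp (-u * (ν - 1))) by ring,
      ← Real.exp_add]
    congr 2
    ring
  rw [intervalIntegral.integral_of_le zero_le_one, integral_Ioc_eq_integral_Ioo, hcv,
    setIntegral_congr_fun measurableSet_Ioi hpt, Real.integral_rpow_mul_exp_neg_mul_Ioi hμ hν,
    Real.div_rpow zero_le_one hν.le, Real.one_rpow, one_div, inv_mul_eq_div]

end Literature.Analysis.SpecialFunctions
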